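import Literature.AlgebraicGeometry.Motives.LefschetzClassesProducts
import Literature.AlgebraicGeometry.Motives.LefschetzClassesIsogeny
import Literature.RingTheory.CentralSimple.BaseChangeSimple
import Mathlib.RingTheory.TensorProduct.Basic
import Mathlib.LinearAlgebra.Dimension.Constructions
import Mathlib.LinearAlgebra.FreeModule.Finite.Matrix
import HarnessLib

/-!
# The endomorphism algebra of an elliptic curve acts on `H¹`: quaternionic `End⁰` gives all of
# `End_K H¹(E)`

For a Weil cohomology theory `W : WeilCohomology k K` (Kleiman 1968, §1.2) and a one-dimensional
abelian variety `E` over `k`, pull-back makes `H¹(E)` (a `K`-plane, `dim H¹ = 2 dim E`) a right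
module over `End E`, additively because degree-one classes are primitive
(`pullback_mul_deg_one`). If the endomorphism algebra `End⁰(E) = ℚ ⊗ End E` is a **central
simple `ℚ`-algebra of dimension `4`** (a quaternion algebra — Deuring's theorem for a
supersingular elliptic curve, Deuring 1941; Silverman, *AEC* V.3.1), then `K ⊗_ℚ End⁰(E)` is
simple (`Literature.RingTheory.CentralSimple.isSimpleRing_tensorProduct`), so the `K`-algebra map
`K ⊗_ℚ End⁰(E) → (End_K H¹(E))ᵒᵖ` is injective, hence bijective by the dimension count `4 = 2²`,
and **the pull-backs `f*`, `f ∈ End E`, span `End_K H¹(E)` over `K`**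
(`span_pullback_one_eq_top_of_endAlgebra`). This is the hypothesis `hspan` of
`Motives/DivisorClassesPowersOfCurve` and `Motives/LefschetzClassesPowersOfCurve`; with it, what
remains of the named fact `LenstraZarhin1993_supersingular_lefschetzClasses_eq_top` is Deuring's
theorem itself and the transport from `k̄` to the algebraically closed base field `k`.

Everything is a theorem; no definitions, no named facts.

## References

* [Kleiman1968] S. Kleiman, *Algebraic cycles and the Weil conjectures* (1968), §1.2, 2A.
* [MumfordAV1970] D. Mumford, *Abelian Varieties* (1970), §19 (the representation of `End⁰` on
  cohomology / the Tate module, Thm. 3 area).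
* [SilvermanAEC2009] J. H. Silverman, *The Arithmetic of Elliptic Curves*, 2nd ed., V.3.1
  (Deuring: supersingular iff `End` is an order in a quaternion algebra).
-/

noncomputable section

universe u v

open CategoryTheory AlgebraicGeometry MonoidalCategory CartesianMonoidalCategory Opposite
open scoped TensorProduct

namespace Literature.AlgebraicGeometry.Motives

namespace WeilCohomology

variable {k : Type u} [Field k] {K : Type v} [Field K] [CharZero K] (W : WeilCohomology k K)

open scoped MonObj

variable {g : ℕ} (E : AbelianVariety k)

/-- **Pull-back on `H¹` is additive in the morphism**: for `k`-morphisms `p q : E → E` (indeed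
from any smooth projective source) with pointwise product `p · q` in the group scheme `E`,
`(p · q)* v = p* v + q* v` for `v ∈ H¹(E)`, because degree-one classes are primitive,
`m* v = pr₁* v + pr₂* v` (`pullback_mu_of_deg_one`; Mumford, *Abelian Varieties*, §1 for the
classical theories). [cite: MumfordAV1970, §1] -/
theorem pullback_mul_deg_one (hE : IsSmoothProjective g E.X) (p q : E.X ⟶ E.X) (v : W.obj E.X 1) :
    W.pullback (p * q) 1 v = W.pullback p 1 v + W.pullback q 1 v := by
  rw [Hom.mul_def, W.pullback_comp, LinearMap.comp_apply, W.pullback_mu_of_deg_one E hE v,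
    map_add, ← LinearMap.comp_apply, ← LinearMap.comp_apply, ← W.pullback_comp,
    ← W.pullback_comp, CartesianMonoidalCategory.lift_fst, CartesianMonoidalCategory.lift_snd]

/-- The zero endomorphism kills `H¹`: `0* v = 0` on `H¹(E)` (the trivial point factors through
`Spec k`; `pullback_one_eq_zero`). [folklore] -/
theorem pullback_hom_zero_deg_one (v : W.obj E.X 1) :
    W.pullback (0 : E ⟶ E).hom.hom.hom 1 v = 0 := by
  rw [AbelianVariety.hom_zero]
  exact W.pullback_one_eq_zero E one_ne_zero v

/-- **The pull-backs of the endomorphisms of a quaternionic elliptic curve span `End_K H¹(E)`.**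
Let `E` be a one-dimensional abelian variety whose endomorphism algebra `End⁰(E) = ℚ ⊗ End E`
is a central simple `ℚ`-algebra of dimension `4`. Then for every Weil cohomology theory `W` the
operators `f*|H¹(E)`, `f : E → E` a `k`-morphism, span `End_K H¹(E)` over `K`: the `K`-algebra
map `K ⊗_ℚ End⁰(E) → (End_K H¹(E))ᵒᵖ`, `c ⊗ (q ⊗ f) ↦ c q · f*`, is a ring homomorphism
(functoriality and `pullback_mul_deg_one`) out of a simple ring (`isSimpleRing_tensorProduct`),
hence injective, hence onto as both sides have `K`-dimension `4` (`dim H¹(E) = 2`,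
`eq_two_mul_dim`). For a supersingular elliptic curve the hypothesis is Deuring's theorem
(Silverman, *AEC* V.3.1); the conclusion is the input `hspan` of
`lefschetzClasses_eq_top_of_isIsogenous_powSucc`. [cite: SilvermanAEC2009, V.3.1] -/
theorem span_pullback_one_eq_top_of_endAlgebra (hE1 : E.dim = 1)
    (hfd : E.finiteDimensional_endAlgebra) [IsSimpleRing E.endAlgebra]
    [Algebra.IsCentral ℚ E.endAlgebra] (h4 : Module.finrank ℚ E.endAlgebra = 4) :
    Submodule.span K (Set.range fun f : E.X ⟶ E.X ↦ W.pullback f 1) = ⊤ := by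
  classical
  have hE : IsSmoothProjective 1 E.X := hE1 ▸ (AbelianVariety.isSmoothProjective_holds (A := E))
  haveI := W.finite_obj hE 1
  -- `dim H¹(E) = 2`
  have h2 : Module.finrank K (W.obj E.X 1) = 2 := by
    obtain ⟨w, hw⟩ := W.exists_pow_ne_zero hE
    have := W.eq_two_mul_dim E hE hw (Module.finBasis K (W.obj E.X 1))
    omega
  haveI : Nontrivial (W.obj E.X 1) := Module.nontrivial_of_finrank_pos (R := K) (by omega)
  -- instances on the type synonym `E.endAlgebra = ℚ ⊗_ℤ End E`
  haveI : Module.Finite ℚ E.endAlgebra := hfd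
  haveI : Module.Free ℚ E.endAlgebra := by
    exact (inferInstance : Module.Free ℚ (ℚ ⊗[ℤ] End E))
  -- the target `K`-algebra `C = (End_K H¹(E))ᵐᵒᵖ`, as a `ℚ`-algebra through `K`
  set V := W.obj E.X 1
  let C := (Module.End K V)ᵐᵒᵖ
  letI iC : Algebra ℚ C :=
    ((algebraMap K C).comp (algebraMap ℚ K)).toAlgebra' fun q x ↦
      Algebra.commutes (algebraMap ℚ K q) x
  haveI : IsScalarTower ℚ K C := IsScalarTower.of_algebraMap_eq fun _ ↦ rfl
  -- the ring homomorphism `End E → C`, `f ↦ f*|H¹`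
  let ρ₀ : End E →+* C :=
    { toFun := fun f ↦ MulOpposite.op (W.pullback f.hom.hom.hom 1)
      map_one' := by
        change MulOpposite.op (W.pullback (𝟙 E.X) 1) = 1
        rw [W.pullback_id]
        rfl
      map_mul' := fun f f' ↦ by
        change MulOpposite.op (W.pullback (f'.hom.hom.hom ≫ f.hom.hom.hom) 1) =
          MulOpposite.op (W.pullback f.hom.hom.hom 1) *
            MulOpposite.op (W.pullback f'.hom.hom.hom 1)
        rw [W.pullback_comp, ← Module.End.mul_eq_comp, MulOpposite.op_mul]
      map_zero' := by
        change MulOpposite.op (W.pullback (0 : E ⟶ E).hom.hom.hom 1) = 0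
        rw [show W.pullback (0 : E ⟶ E).hom.hom.hom 1 = 0 from
          LinearMap.ext (W.pullback_hom_zero_deg_one E), MulOpposite.op_zero]
      map_add' := fun f f' ↦ by
        change MulOpposite.op (W.pullback (f + f').hom.hom.hom 1) =
          MulOpposite.op (W.pullback f.hom.hom.hom 1) +
            MulOpposite.op (W.pullback f'.hom.hom.hom 1)
        rw [← MulOpposite.op_add]
        congr 1
        refine LinearMap.ext fun v ↦ ?_
        change W.pullback (f.hom.hom.hom * f'.hom.hom.hom) 1 v = _
        rw [W.pullback_mul_deg_one E hE, LinearMap.add_apply] }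
  -- as a `ℤ`-algebra homomorphism (any two ring maps out of `ℤ` agree)
  let g₀ : End E →ₐ[ℤ] C :=
    { ρ₀ with
      commutes' := fun n ↦ RingHom.congr_fun
        (RingHom.ext_int (ρ₀.comp (algebraMap ℤ (End E))) (algebraMap ℤ C)) n }
  -- its extension to `End⁰(E) = ℚ ⊗ End E` and then to `K ⊗_ℚ End⁰(E)`
  let ρ₁ : E.endAlgebra →ₐ[ℚ] C :=
    Algebra.TensorProduct.lift (Algebra.ofId ℚ C) g₀ fun q f ↦
      Algebra.commute_algebraMap_left q _
  have hρ₁ : ∀ (q : ℚ) (f : End E), ρ₁ (q ⊗ₜ[ℤ] f) =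
      algebraMap ℚ C q * MulOpposite.op (W.pullback f.hom.hom.hom 1) := fun q f ↦ by
    change Algebra.TensorProduct.lift _ _ _ (q ⊗ₜ[ℤ] f) = _
    rw [Algebra.TensorProduct.lift_tmul]
    rfl
  let ρ₂ : K ⊗[ℚ] E.endAlgebra →ₐ[K] C :=
    Algebra.TensorProduct.lift (Algebra.ofId K C) ρ₁ fun c d ↦ Algebra.commute_algebraMap_left c _
  have hρ₂ : ∀ (c : K) (d : E.endAlgebra), ρ₂ (c ⊗ₜ[ℚ] d) = algebraMap K C c * ρ₁ d :=
    fun c d ↦ by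
      change Algebra.TensorProduct.lift _ _ _ (c ⊗ₜ[ℚ] d) = _
      rw [Algebra.TensorProduct.lift_tmul]
      rfl
  -- `K ⊗_ℚ End⁰(E)` is simple, so `ρ₂` is injective, hence onto by dimensions
  haveI : IsSimpleRing (K ⊗[ℚ] E.endAlgebra) :=
    Literature.RingTheory.CentralSimple.isSimpleRing_tensorProduct K
  have hinj : Function.Injective ρ₂.toLinearMap := RingHom.injective ρ₂.toRingHom
  have hC : Module.finrank K C = 4 := by
    rw [(MulOpposite.opLinearEquiv K : Module.End K V ≃ₗ[K] C).symm.finrank_eq,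
      Module.finrank_linearMap K K V V, h2]
  have hB : Module.finrank K (K ⊗[ℚ] E.endAlgebra) = 4 := by
    rw [Module.finrank_baseChange, h4]
  have hrange : LinearMap.range ρ₂.toLinearMap = ⊤ := by
    haveI : Module.Finite K C := Module.finite_of_finrank_pos (by rw [hC]; norm_num)
    apply Submodule.eq_top_of_finrank_eq
    rw [LinearMap.finrank_range_of_inj hinj, hB, hC]
  -- the range is contained in the span of the `op f*`
  have hmem₁ : ∀ d : E.endAlgebra, ρ₁ d ∈
      Submodule.span K (Set.range fun f : E.X ⟶ E.X ↦ MulOpposite.op (W.pullback f 1)) := by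
    intro d
    induction d using TensorProduct.induction_on with
    | zero =>
      show ρ₁ (0 : E.endAlgebra) ∈ _
      rw [map_zero]
      exact zero_mem _
    | tmul q f =>
      rw [hρ₁, ← Algebra.smul_def]
      exact Submodule.smul_of_tower_mem _ q (Submodule.subset_span ⟨f.hom.hom.hom, rfl⟩)
    | add x y hx hy =>
      have h := add_mem hx hy
      rw [← map_add] at h
      exact h
  have hle : LinearMap.range ρ₂.toLinearMap ≤
      Submodule.span K (Set.range fun f : E.X ⟶ E.X ↦ MulOpposite.op (W.pullback f 1)) := by
    rintro _ ⟨b, rfl⟩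
    induction b using TensorProduct.induction_on with
    | zero => rw [map_zero]; exact zero_mem _
    | add b b' hb hb' => rw [map_add]; exact add_mem hb hb'
    | tmul c d =>
      rw [AlgHom.toLinearMap_apply, hρ₂, ← Algebra.smul_def]
      exact Submodule.smul_mem _ c (hmem₁ d)
  -- conclude: the `op f*` span `C`, so the `f*` span `End_K H¹(E)`
  have hspanop : Submodule.span K
      (Set.range fun f : E.X ⟶ E.X ↦ MulOpposite.op (W.pullback f 1)) = ⊤ :=
    eq_top_iff.2 (hrange.ge.trans hle)
  have himage : (Set.range fun f : E.X ⟶ E.X ↦ MulOpposite.op (W.pullback f 1)) =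
      ((MulOpposite.opLinearEquiv K : Module.End K V ≃ₗ[K] C) : Module.End K V →ₗ[K] C) ''
        (Set.range fun f : E.X ⟶ E.X ↦ W.pullback f 1) := by
    rw [← Set.range_comp]
    rfl
  rw [eq_top_iff]
  rintro T -
  have hT : MulOpposite.op T ∈
      Submodule.span K (Set.range fun f : E.X ⟶ E.X ↦ MulOpposite.op (W.pullback f 1)) := by
    rw [hspanop]; trivial
  rw [himage, ← Submodule.map_span] at hT
  exact (Submodule.mem_map_equiv (e := (MulOpposite.opLinearEquiv K : Module.End K V ≃ₗ[K] C))
    (p := Submodule.span K (Set.range fun f : E.X ⟶ E.X ↦ W.pullback f 1))).1 hT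

end WeilCohomology

end Literature.AlgebraicGeometry.Motives

end
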